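import Summits.CriticalPhenomena.PercolationContinuityZ3.Theorems.PercNearOneGluingNoHeavyLowerTailKnQuestion8CoefficientwiseRootSectorTwo
import Summits.CriticalPhenomena.PercolationContinuityZ3.Theorems.PercNearOneGluingNoHeavyLowerTailKnQuestion8CoefficientwiseZoneFlip
import HarnessLib

/-!
# The point row with ONE point at a root of degree two: the blue-cluster flip (prim-lf-2 gen 42, THEOREM R42)

Support file (`--supports stmt-CriticalPhenomena-4575`, closed), prover `prim-lf-2` (gen 42).  No definitions, no named facts, no sorries;
standard axioms.  Memo `prim-lf-2/CW-ROOTFLIP-gen42.md`; notation of `prim-lf-2/CW-POINTS-gen32.md`, `prim-lf-2/CW-SECTORS-gen37.md` and of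
`…CoefficientwiseRootSectorTwo` (gen 37/38, whose sector identity this file instantiates).  Companion of gen 41's `…CoefficientwiseRootAdjPoints`
(the case `N(x) = {u, w}`, by Harris twice); here the second root neighbour `q` is ARBITRARY and the proof is an explicit injection.

Setting.  Multigraph `ends : ι → Sym2 V` on an edge set `E`, root `x`, wall SET `Z ∌ x`, colourings `s ⊔ (E ∖ s)`, red cluster `C_x(s)`, blue cluster
`C_x(E ∖ s)`, `σ_v(s) = 1[v ∈ C_x s] − 1[v ∈ C_x (E ∖ s)]`, wall event `W_E = {s : Z ∩ (C_x s ∪ C_x (E∖s)) = ∅}`; the POINT ROW of the coefficientwise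
vdBHK-PA programme is the conjecture `0 ≤ Σ_{W_E} σ_u σ_w` (CW-POINTS-gen32; open in general).

**THEOREM R42 (this file).**  If the only edges of `E` at `x` are `e₁ = {x,u}` and `e₂ = {x,q}` — ONE of the two points is a root neighbour and the root
has (simple) degree two, the other root neighbour `q` and the other point `w` being arbitrary — then `0 ≤ Σ_{W_E} σ_u σ_w` for every wall set `Z ∌ x`
and every multigraph `H = G − x` behind.
Proof.  By the root-sector identity (`pointRow_nonneg_of_rootDegTwo` with `p = u`) it suffices to show `0 ≤ N_pure + M` on `E' = E ∖ {e₁,e₂}`, where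
`N_pure = #𝒫`, `𝒫 = {t ⊆ E' : Z ∩ C_u(t) = ∅ = Z ∩ C_q(t), w ∈ C_u(t) ∪ C_q(t)}` (the factor `1[u ∈ C_u t ∪ C_q t]` is `1`), and every term of the mixed
sum `M = Σ (1 − 1[u ∈ B])(1[w ∈ C_u t] − 1[w ∈ B])`, `B = C_q(E'∖t)` the BLUE cluster of `q`, is `≥ −1`, and `= −1` only on
`𝒳 = {t : Z ∩ C_u(t) = ∅ = Z ∩ B, u ∉ B, w ∈ B}`.  THE FLIP `φ(t) = t ∆ M(t)`, `M(t)` = the edges of `E'` meeting `B`, recolours every edge at the blue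
cluster of `q`: afterwards the RED cluster of `q` is exactly `B` (`openCluster_relFlip`), so `w ∈ C_q(φ t)` and `Z ∩ C_q(φ t) = ∅`, while the red cluster of
`u ∉ B` can only shrink (`openCluster_relFlip_subset`), so `Z ∩ C_u(φ t) = ∅`: `φ(𝒳) ⊆ 𝒫`.  `φ` is injective (`relFlip_relFlip`: it is undone by recolouring the
edges at the new red cluster of `q`).  Hence `#𝒳 ≤ #𝒫` and `N_pure + M ≥ #𝒫 − #𝒳 ≥ 0`.  In the language of CW-SECTORS-gen37: PURE DOMINATION (all crossings of the
mixed sector inject into the pure count), refuted in general from 8 vertices (types A/B there), HOLDS whenever a point sits at a degree-two root.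
* `Coefficientwise.openCluster_relFlip`, `Coefficientwise.openCluster_relFlip_subset`, `Coefficientwise.relFlip_subset`, `Coefficientwise.relFlip_relFlip` —
  the half-zone flip of prim-cplus-coupling's `…CoefficientwiseHalfFlip` RELATIVE to an edge set `E₀` (blue = `E₀ ∖ t` instead of `tᶜ`).
* `Coefficientwise.pointRow_nonneg_of_rootAdjPoint` — **THE THEOREM**.
[cite: KozmaNitzan2024, Questions 8–9 (§5.5 p. 36) (context: the Question-8 pocket covariance programme; the flip is elementary)]
-/

namespace Summit.CriticalPhenomena.PercolationContinuityZ3.Theorems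

open Finset Literature.Probability.Percolation
open scoped symmDiff

namespace Coefficientwise

variable {ι V : Type*} (ends : ι → Sym2 V)

section flip

variable [DecidableEq ι]

/-- **Relative half-zone flip.**  `t ⊆ E₀`, `B = C_q(E₀ ∖ t)` the blue cluster of `q`, `M` the edges of `E₀` meeting `B`.  After recolouring `M` the RED cluster
of `q` is `B`: `C_q(t ∆ M) = C_q(E₀ ∖ t)`.  (Walk transfer inside `B` in both directions: an edge of `t ∆ M` at `B` lies in `M`, hence was blue, hence has both
ends in `B`; a blue edge at `B` lies in `M ∖ t ⊆ t ∆ M`.) [this work] -/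
theorem openCluster_relFlip (E₀ t M : Finset ι) (q : V) (ht : t ⊆ E₀)
    (hM : ∀ i, i ∈ M ↔ i ∈ E₀ ∧ ∃ v, v ∈ openCluster (ends '' (↑(E₀ \ t) : Set ι)) q ∧ v ∈ ends i) :
    openCluster (ends '' (↑(t ∆ M) : Set ι)) q = openCluster (ends '' (↑(E₀ \ t) : Set ι)) q := by
  set ZB : Set V := openCluster (ends '' (↑(E₀ \ t) : Set ι)) q with hZB
  have h1 : ∀ a ∈ ZB, ∀ b, (openGraph (ends '' (↑(t ∆ M) : Set ι))).Adj a b →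
      (openGraph (ends '' (↑(E₀ \ t) : Set ι))).Adj a b ∧ b ∈ ZB := by
    intro a ha b hadj
    rw [openGraph_image_adj] at hadj
    obtain ⟨⟨i, hiP, hi⟩, hne⟩ := hadj
    have hai : a ∈ ends i := by rw [hi]; exact Sym2.mem_mk_left a b
    have hbi : b ∈ ends i := by rw [hi]; exact Sym2.mem_mk_right a b
    have hiE : i ∈ E₀ := by
      rw [Finset.mem_symmDiff] at hiP
      rcases hiP with ⟨hit, _⟩ | ⟨hiM, _⟩
      · exact ht hit
      · exact ((hM i).mp hiM).1
    have hiM : i ∈ M := (hM i).mpr ⟨hiE, a, ha, hai⟩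
    have hit : i ∉ t := by
      rw [Finset.mem_symmDiff] at hiP
      rcases hiP with ⟨_, hnM⟩ | ⟨_, hnt⟩
      · exact absurd hiM hnM
      · exact hnt
    have hib : i ∈ E₀ \ t := Finset.mem_sdiff.mpr ⟨hiE, hit⟩
    have hadj' : (openGraph (ends '' (↑(E₀ \ t) : Set ι))).Adj a b := by
      rw [openGraph_image_adj]; exact ⟨⟨i, hib, hi⟩, hne⟩
    exact ⟨hadj', mem_openCluster_of_mem_ends ends (E₀ \ t) q hib ha hai hbi⟩
  have h2 : ∀ a ∈ ZB, ∀ b, (openGraph (ends '' (↑(E₀ \ t) : Set ι))).Adj a b →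
      (openGraph (ends '' (↑(t ∆ M) : Set ι))).Adj a b ∧ b ∈ ZB := by
    intro a ha b hadj
    rw [openGraph_image_adj] at hadj
    obtain ⟨⟨i, hib, hi⟩, hne⟩ := hadj
    have hai : a ∈ ends i := by rw [hi]; exact Sym2.mem_mk_left a b
    have hbi : b ∈ ends i := by rw [hi]; exact Sym2.mem_mk_right a b
    have hiE : i ∈ E₀ := (Finset.mem_sdiff.mp hib).1
    have hit : i ∉ t := (Finset.mem_sdiff.mp hib).2
    have hiM : i ∈ M := (hM i).mpr ⟨hiE, a, ha, hai⟩
    have hiP : i ∈ t ∆ M := Finset.mem_symmDiff.mpr (Or.inr ⟨hiM, hit⟩)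
    refine ⟨?_, mem_openCluster_of_mem_ends ends (E₀ \ t) q hib ha hai hbi⟩
    rw [openGraph_image_adj]; exact ⟨⟨i, hiP, hi⟩, hne⟩
  have hq : q ∈ ZB := mem_openCluster_self _ q
  ext y
  constructor
  · rintro ⟨p⟩; exact ((reachable_transfer ZB h1 p) hq).2
  · rintro ⟨p⟩; exact ((reachable_transfer ZB h2 p) hq).1

/-- Under the relative half-zone flip the red cluster of a vertex `x ∉ C_q(E₀ ∖ t)` can only shrink: `C_x(t ∆ M) ⊆ C_x(t)`.  (A walk from `x` that is red
after the flip never meets `V(C_q(E₀∖t))`: an edge into that set which is red after the flip lies in `M`, so it was blue, so both its ends were inside.)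
[this work] -/
theorem openCluster_relFlip_subset (E₀ t M : Finset ι) (q x : V) (ht : t ⊆ E₀)
    (hM : ∀ i, i ∈ M ↔ i ∈ E₀ ∧ ∃ v, v ∈ openCluster (ends '' (↑(E₀ \ t) : Set ι)) q ∧ v ∈ ends i)
    (hx : x ∉ openCluster (ends '' (↑(E₀ \ t) : Set ι)) q) :
    openCluster (ends '' (↑(t ∆ M) : Set ι)) x ⊆ openCluster (ends '' (↑t : Set ι)) x := by
  set ZB : Set V := openCluster (ends '' (↑(E₀ \ t) : Set ι)) q with hZB
  set K : Set V := openCluster (ends '' (↑t : Set ι)) x with hK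
  have h : ∀ a ∈ (K ∩ ZBᶜ), ∀ b, (openGraph (ends '' (↑(t ∆ M) : Set ι))).Adj a b →
      (openGraph (ends '' (↑t : Set ι))).Adj a b ∧ b ∈ (K ∩ ZBᶜ) := by
    intro a ha b hadj
    rw [openGraph_image_adj] at hadj
    obtain ⟨⟨i, hiP, hi⟩, hne⟩ := hadj
    have hai : a ∈ ends i := by rw [hi]; exact Sym2.mem_mk_left a b
    have hbi : b ∈ ends i := by rw [hi]; exact Sym2.mem_mk_right a b
    -- the edge `i` is not at `ZB`: otherwise it was blue and both its ends are in `ZB`, contradicting `a ∉ ZB`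
    have hiM : i ∉ M := by
      intro hiM
      obtain ⟨hiE, a', ha'Z, ha'i⟩ := (hM i).mp hiM
      have hit : i ∉ t := by
        rw [Finset.mem_symmDiff] at hiP
        rcases hiP with ⟨_, hnM⟩ | ⟨_, hnt⟩
        · exact absurd hiM hnM
        · exact hnt
      have hib : i ∈ E₀ \ t := Finset.mem_sdiff.mpr ⟨hiE, hit⟩
      have haZ : a ∈ ZB := mem_openCluster_of_mem_ends ends (E₀ \ t) q hib ha'Z ha'i hai
      exact ha.2 haZ
    have hit : i ∈ t := by
      rw [Finset.mem_symmDiff] at hiP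
      rcases hiP with ⟨hit, _⟩ | ⟨hiM', _⟩
      · exact hit
      · exact absurd hiM' hiM
    have hadj' : (openGraph (ends '' (↑t : Set ι))).Adj a b := by
      rw [openGraph_image_adj]; exact ⟨⟨i, hit, hi⟩, hne⟩
    refine ⟨hadj', SimpleGraph.Reachable.trans ha.1 hadj'.reachable, ?_⟩
    intro hbZ
    obtain ⟨hiE, -⟩ : i ∈ E₀ ∧ True := ⟨ht hit, trivial⟩
    exact hiM ((hM i).mpr ⟨hiE, b, hbZ, hbi⟩)
  intro y hy
  obtain ⟨p⟩ := hy
  have hx' : x ∈ K ∩ ZBᶜ := ⟨mem_openCluster_self _ x, hx⟩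
  exact ((reachable_transfer (K ∩ ZBᶜ) h p) hx').2.1

/-- The flipped colouring stays inside `E₀`. [this work] -/
theorem relFlip_subset (E₀ t M : Finset ι) (q : V) (ht : t ⊆ E₀)
    (hM : ∀ i, i ∈ M ↔ i ∈ E₀ ∧ ∃ v, v ∈ openCluster (ends '' (↑(E₀ \ t) : Set ι)) q ∧ v ∈ ends i) :
    t ∆ M ⊆ E₀ := by
  intro i hi
  rw [Finset.mem_symmDiff] at hi
  rcases hi with ⟨hit, _⟩ | ⟨hiM, _⟩
  · exact ht hit
  · exact ((hM i).mp hiM).1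

/-- The relative half-zone flip is undone by recolouring the edges of `E₀` at the NEW red cluster of `q`: if `M'` is the set of edges of `E₀` meeting
`C_q(t ∆ M)` then `M' = M` and `(t ∆ M) ∆ M' = t`.  Hence the flip is injective. [this work] -/
theorem relFlip_relFlip (E₀ t M M' : Finset ι) (q : V) (ht : t ⊆ E₀)
    (hM : ∀ i, i ∈ M ↔ i ∈ E₀ ∧ ∃ v, v ∈ openCluster (ends '' (↑(E₀ \ t) : Set ι)) q ∧ v ∈ ends i)
    (hM' : ∀ i, i ∈ M' ↔ i ∈ E₀ ∧ ∃ v, v ∈ openCluster (ends '' (↑(t ∆ M) : Set ι)) q ∧ v ∈ ends i) :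
    (t ∆ M) ∆ M' = t := by
  have hMM : M' = M := by
    ext i
    rw [hM i, hM' i, openCluster_relFlip ends E₀ t M q ht hM]
  rw [hMM]
  exact symmDiff_symmDiff_cancel_right _ _

end flip

section main

variable [DecidableEq ι]

open Classical in
/-- **THEOREM R42 (prim-lf-2 gen 42): the point row holds when one point is a root neighbour and the root has degree two.**
Let the only edges of `E` at `x` be `e₁ ≠ e₂` with `ends e₁ = {x,u}`, `ends e₂ = {x,q}` (`q` arbitrary), `u, w ≠ x`, and let `Z ∌ x` be any wall set.  Then
`0 ≤ Σ_{s ⊆ E : ∀ z ∈ Z, z ∉ C_x(s), z ∉ C_x(E ∖ s)} σ_u(s)·σ_w(s)`.  Proof: `pointRow_nonneg_of_rootDegTwo` with `p = u`; the pure sum is `#𝒫`; every mixed term is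
`≥ −1[t ∈ 𝒳]`; and the blue-cluster flip `t ↦ t ∆ M(t)` injects `𝒳` into `𝒫` (`openCluster_relFlip`, `openCluster_relFlip_subset`, `relFlip_relFlip`).
[cite: KozmaNitzan2024, Questions 8–9 (§5.5 p. 36) (context; the argument is an elementary injection)] -/
theorem pointRow_nonneg_of_rootAdjPoint (E : Finset ι) {x u q w : V} {e₁ e₂ : ι} (he₁ : e₁ ∈ E) (he₂ : e₂ ∈ E) (hne : e₁ ≠ e₂)
    (h₁ : ends e₁ = s(x, u)) (h₂ : ends e₂ = s(x, q)) (hroot : ∀ i ∈ E, x ∈ ends i → i = e₁ ∨ i = e₂)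
    (hux : u ≠ x) (hwx : w ≠ x) (Z : Set V) (hxZ : x ∉ Z) :
    0 ≤ ∑ s ∈ E.powerset.filter (fun s : Finset ι => ∀ z ∈ Z, z ∉ openCluster (ends '' (↑(s) : Set ι)) x ∧ z ∉ openCluster (ends '' (↑(E \ s) : Set ι)) x),
      ((if u ∈ openCluster (ends '' (↑(s) : Set ι)) x then (1 : ℝ) else 0) - (if u ∈ openCluster (ends '' (↑(E \ s) : Set ι)) x then (1 : ℝ) else 0)) *
        ((if w ∈ openCluster (ends '' (↑(s) : Set ι)) x then (1 : ℝ) else 0) - (if w ∈ openCluster (ends '' (↑(E \ s) : Set ι)) x then (1 : ℝ) else 0)) := by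
  apply pointRow_nonneg_of_rootDegTwo ends E he₁ he₂ hne h₁ h₂ hroot u w hux hwx Z hxZ
  set E' : Finset ι := (E.erase e₁).erase e₂ with hE'
  -- the pure set 𝒫 and the negative mixed set 𝒳
  set Pset : Finset (Finset ι) := E'.powerset.filter (fun t : Finset ι => (∀ z ∈ Z,
      z ∉ openCluster (ends '' (↑(t) : Set ι)) u ∧ z ∉ openCluster (ends '' (↑(t) : Set ι)) q) ∧
      (w ∈ openCluster (ends '' (↑(t) : Set ι)) u ∨ w ∈ openCluster (ends '' (↑(t) : Set ι)) q)) with hPset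
  set Xset : Finset (Finset ι) := E'.powerset.filter (fun t : Finset ι => (∀ z ∈ Z,
      z ∉ openCluster (ends '' (↑(t) : Set ι)) u ∧ z ∉ openCluster (ends '' (↑(E' \ t) : Set ι)) q) ∧
      u ∉ openCluster (ends '' (↑(E' \ t) : Set ι)) q ∧ w ∈ openCluster (ends '' (↑(E' \ t) : Set ι)) q) with hXset
  -- (1) the pure sum equals #𝒫
  have hpure : ∑ t ∈ E'.powerset.filter (fun t : Finset ι => ∀ z ∈ Z,
          z ∉ openCluster (ends '' (↑(t) : Set ι)) u ∧ z ∉ openCluster (ends '' (↑(t) : Set ι)) q),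
      (if (u ∈ openCluster (ends '' (↑(t) : Set ι)) u ∨ u ∈ openCluster (ends '' (↑(t) : Set ι)) q) then (1 : ℝ) else 0) *
        (if (w ∈ openCluster (ends '' (↑(t) : Set ι)) u ∨ w ∈ openCluster (ends '' (↑(t) : Set ι)) q) then (1 : ℝ) else 0) =
      (Pset.card : ℝ) := by
    rw [hPset, Finset.card_filter, Nat.cast_sum]
    simp only [Nat.cast_ite, Nat.cast_one, Nat.cast_zero]
    rw [Finset.sum_filter]
    refine Finset.sum_congr rfl fun t _ => ?_
    by_cases hwall : (∀ z ∈ Z, z ∉ openCluster (ends '' (↑(t) : Set ι)) u ∧ z ∉ openCluster (ends '' (↑(t) : Set ι)) q)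
    · rw [if_pos hwall, if_pos (Or.inl (mem_openCluster_self _ _)), one_mul]
      by_cases hw : (w ∈ openCluster (ends '' (↑(t) : Set ι)) u ∨ w ∈ openCluster (ends '' (↑(t) : Set ι)) q)
      · rw [if_pos hw, if_pos ⟨hwall, hw⟩]
      · rw [if_neg hw, if_neg (fun h => hw h.2)]
    · rw [if_neg hwall, if_neg (fun h => hwall h.1)]
  -- (2) the mixed sum is ≥ -#𝒳
  have hmixed : -(Xset.card : ℝ) ≤
      ∑ t ∈ E'.powerset.filter (fun t : Finset ι => ∀ z ∈ Z,
          z ∉ openCluster (ends '' (↑(t) : Set ι)) u ∧ z ∉ openCluster (ends '' (↑(E' \ t) : Set ι)) q),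
      ((if u ∈ openCluster (ends '' (↑(t) : Set ι)) u then (1 : ℝ) else 0) -
          (if u ∈ openCluster (ends '' (↑(E' \ t) : Set ι)) q then (1 : ℝ) else 0)) *
        ((if w ∈ openCluster (ends '' (↑(t) : Set ι)) u then (1 : ℝ) else 0) -
          (if w ∈ openCluster (ends '' (↑(E' \ t) : Set ι)) q then (1 : ℝ) else 0)) := by
    rw [hXset, Finset.card_filter, Nat.cast_sum]
    simp only [Nat.cast_ite, Nat.cast_one, Nat.cast_zero]
    rw [Finset.sum_filter, ← Finset.sum_neg_distrib]
    refine Finset.sum_le_sum fun t _ => ?_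
    by_cases hwall : (∀ z ∈ Z, z ∉ openCluster (ends '' (↑(t) : Set ι)) u ∧ z ∉ openCluster (ends '' (↑(E' \ t) : Set ι)) q)
    · rw [if_pos hwall, if_pos (mem_openCluster_self _ _)]
      by_cases hu : u ∈ openCluster (ends '' (↑(E' \ t) : Set ι)) q
      · rw [if_pos hu, if_neg (fun h => h.2.1 hu)]; norm_num
      · rw [if_neg hu]
        by_cases hwB : w ∈ openCluster (ends '' (↑(E' \ t) : Set ι)) q
        · rw [if_pos hwB, if_pos ⟨hwall, hu, hwB⟩]
          split_ifs <;> norm_num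
        · rw [if_neg hwB, if_neg (fun h => hwB h.2.2)]
          split_ifs <;> norm_num
    · rw [if_neg hwall, if_neg (fun h => hwall h.1)]; norm_num
  -- (3) the flip injects 𝒳 into 𝒫
  have hinj : Xset.card ≤ Pset.card := by
    refine Finset.card_le_card_of_injOn
      (fun t => t ∆ (E'.filter (fun i => ∃ v, v ∈ openCluster (ends '' (↑(E' \ t) : Set ι)) q ∧ v ∈ ends i))) ?_ ?_
    · -- maps into 𝒫
      intro t ht
      rw [Finset.mem_coe, hXset, Finset.mem_filter, Finset.mem_powerset] at ht
      obtain ⟨htE, hwall, huB, hwB⟩ := ht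
      have hM : ∀ i, i ∈ (E'.filter (fun i => ∃ v, v ∈ openCluster (ends '' (↑(E' \ t) : Set ι)) q ∧ v ∈ ends i)) ↔
          i ∈ E' ∧ ∃ v, v ∈ openCluster (ends '' (↑(E' \ t) : Set ι)) q ∧ v ∈ ends i := by
        intro i; rw [Finset.mem_filter]
      have hflip := openCluster_relFlip ends E' t _ q htE hM
      have hsub := openCluster_relFlip_subset ends E' t _ q u htE hM huB
      rw [Finset.mem_coe, hPset, Finset.mem_filter, Finset.mem_powerset]
      refine ⟨relFlip_subset ends E' t _ q htE hM, ?_, ?_⟩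
      · intro z hz
        refine ⟨fun hzu => (hwall z hz).1 (hsub hzu), ?_⟩
        rw [hflip]; exact (hwall z hz).2
      · right; rw [hflip]; exact hwB
    · -- injective
      intro t₁ ht₁ t₂ ht₂ heq
      rw [Finset.mem_coe, hXset, Finset.mem_filter, Finset.mem_powerset] at ht₁ ht₂
      have hM₁ : ∀ i, i ∈ (E'.filter (fun i => ∃ v, v ∈ openCluster (ends '' (↑(E' \ t₁) : Set ι)) q ∧ v ∈ ends i)) ↔
          i ∈ E' ∧ ∃ v, v ∈ openCluster (ends '' (↑(E' \ t₁) : Set ι)) q ∧ v ∈ ends i := by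
        intro i; rw [Finset.mem_filter]
      have hM₂ : ∀ i, i ∈ (E'.filter (fun i => ∃ v, v ∈ openCluster (ends '' (↑(E' \ t₂) : Set ι)) q ∧ v ∈ ends i)) ↔
          i ∈ E' ∧ ∃ v, v ∈ openCluster (ends '' (↑(E' \ t₂) : Set ι)) q ∧ v ∈ ends i := by
        intro i; rw [Finset.mem_filter]
      -- abbreviate the two flipped colourings
      have heq' : t₁ ∆ (E'.filter (fun i => ∃ v, v ∈ openCluster (ends '' (↑(E' \ t₁) : Set ι)) q ∧ v ∈ ends i)) =
          t₂ ∆ (E'.filter (fun i => ∃ v, v ∈ openCluster (ends '' (↑(E' \ t₂) : Set ι)) q ∧ v ∈ ends i)) := heq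
      have hM'₁ : ∀ i, i ∈ (E'.filter (fun i => ∃ v, v ∈ openCluster (ends ''
            (↑(t₁ ∆ (E'.filter (fun i => ∃ v, v ∈ openCluster (ends '' (↑(E' \ t₁) : Set ι)) q ∧ v ∈ ends i))) : Set ι)) q ∧ v ∈ ends i)) ↔
          i ∈ E' ∧ ∃ v, v ∈ openCluster (ends ''
            (↑(t₁ ∆ (E'.filter (fun i => ∃ v, v ∈ openCluster (ends '' (↑(E' \ t₁) : Set ι)) q ∧ v ∈ ends i))) : Set ι)) q ∧ v ∈ ends i := by
        intro i; rw [Finset.mem_filter]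
      have hM'₂ : ∀ i, i ∈ (E'.filter (fun i => ∃ v, v ∈ openCluster (ends ''
            (↑(t₁ ∆ (E'.filter (fun i => ∃ v, v ∈ openCluster (ends '' (↑(E' \ t₁) : Set ι)) q ∧ v ∈ ends i))) : Set ι)) q ∧ v ∈ ends i)) ↔
          i ∈ E' ∧ ∃ v, v ∈ openCluster (ends ''
            (↑(t₂ ∆ (E'.filter (fun i => ∃ v, v ∈ openCluster (ends '' (↑(E' \ t₂) : Set ι)) q ∧ v ∈ ends i))) : Set ι)) q ∧ v ∈ ends i := by
        intro i; rw [Finset.mem_filter, heq']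
      have h1 := relFlip_relFlip ends E' t₁ _ _ q ht₁.1 hM₁ hM'₁
      have h2 := relFlip_relFlip ends E' t₂ _ _ q ht₂.1 hM₂ hM'₂
      rw [← h1, ← h2, heq']
  have hinjR : (Xset.card : ℝ) ≤ (Pset.card : ℝ) := by exact_mod_cast hinj
  rw [hpure]
  linarith

open Classical in
/-- **COROLLARY R42′ (the whole class 'a point at a simple degree-two root').**  If the only edges of `E` at `x` are `e₁ ≠ e₂` with ends `{x,p}`, `{x,q}`,
and one of the root neighbours `p, q` is one of the points `u, w` (four cases; `p = u` is THEOREM R42, `{p,q} = {u,w}` contains gen 41's T41.1), then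
`0 ≤ Σ_{W_E} σ_u σ_w` for every wall set `Z ∌ x`.  Proof: R42 after exchanging `e₁ ↔ e₂` and/or `u ↔ w` (the summand is symmetric in `u, w`).
[cite: KozmaNitzan2024, Questions 8–9 (§5.5 p. 36) (context; elementary symmetry reduction)] -/
theorem pointRow_nonneg_of_rootDegTwo_point (E : Finset ι) {x p q u w : V} {e₁ e₂ : ι} (he₁ : e₁ ∈ E) (he₂ : e₂ ∈ E) (hne : e₁ ≠ e₂)
    (h₁ : ends e₁ = s(x, p)) (h₂ : ends e₂ = s(x, q)) (hroot : ∀ i ∈ E, x ∈ ends i → i = e₁ ∨ i = e₂)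
    (hpt : p = u ∨ p = w ∨ q = u ∨ q = w) (hux : u ≠ x) (hwx : w ≠ x) (Z : Set V) (hxZ : x ∉ Z) :
    0 ≤ ∑ s ∈ E.powerset.filter (fun s : Finset ι => ∀ z ∈ Z, z ∉ openCluster (ends '' (↑(s) : Set ι)) x ∧ z ∉ openCluster (ends '' (↑(E \ s) : Set ι)) x),
      ((if u ∈ openCluster (ends '' (↑(s) : Set ι)) x then (1 : ℝ) else 0) - (if u ∈ openCluster (ends '' (↑(E \ s) : Set ι)) x then (1 : ℝ) else 0)) *
        ((if w ∈ openCluster (ends '' (↑(s) : Set ι)) x then (1 : ℝ) else 0) - (if w ∈ openCluster (ends '' (↑(E \ s) : Set ι)) x then (1 : ℝ) else 0)) := by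
  have hroot' : ∀ i ∈ E, x ∈ ends i → i = e₂ ∨ i = e₁ := fun i hi hx => (hroot i hi hx).symm
  -- the summand is symmetric in `u, w`
  have hsymm : ∀ (a b : V),
      (∑ s ∈ E.powerset.filter (fun s : Finset ι => ∀ z ∈ Z, z ∉ openCluster (ends '' (↑(s) : Set ι)) x ∧ z ∉ openCluster (ends '' (↑(E \ s) : Set ι)) x),
        ((if a ∈ openCluster (ends '' (↑(s) : Set ι)) x then (1 : ℝ) else 0) - (if a ∈ openCluster (ends '' (↑(E \ s) : Set ι)) x then (1 : ℝ) else 0)) *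
          ((if b ∈ openCluster (ends '' (↑(s) : Set ι)) x then (1 : ℝ) else 0) - (if b ∈ openCluster (ends '' (↑(E \ s) : Set ι)) x then (1 : ℝ) else 0))) =
      (∑ s ∈ E.powerset.filter (fun s : Finset ι => ∀ z ∈ Z, z ∉ openCluster (ends '' (↑(s) : Set ι)) x ∧ z ∉ openCluster (ends '' (↑(E \ s) : Set ι)) x),
        ((if b ∈ openCluster (ends '' (↑(s) : Set ι)) x then (1 : ℝ) else 0) - (if b ∈ openCluster (ends '' (↑(E \ s) : Set ι)) x then (1 : ℝ) else 0)) *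
          ((if a ∈ openCluster (ends '' (↑(s) : Set ι)) x then (1 : ℝ) else 0) - (if a ∈ openCluster (ends '' (↑(E \ s) : Set ι)) x then (1 : ℝ) else 0))) :=
    fun a b => Finset.sum_congr rfl fun s _ => mul_comm _ _
  rcases hpt with hp | hp | hq | hq
  · subst hp; exact pointRow_nonneg_of_rootAdjPoint ends E he₁ he₂ hne h₁ h₂ hroot hux hwx Z hxZ
  · subst hp; rw [hsymm]; exact pointRow_nonneg_of_rootAdjPoint ends E he₁ he₂ hne h₁ h₂ hroot hwx hux Z hxZ
  · subst hq; exact pointRow_nonneg_of_rootAdjPoint ends E he₂ he₁ hne.symm h₂ h₁ hroot' hux hwx Z hxZ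
  · subst hq; rw [hsymm]; exact pointRow_nonneg_of_rootAdjPoint ends E he₂ he₁ hne.symm h₂ h₁ hroot' hwx hux Z hxZ

end main

end Coefficientwise

end Summit.CriticalPhenomena.PercolationContinuityZ3.Theorems
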